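import Literature.MathematicalPhysics.QuantumFieldTheory.Balaban1983to89.B15BasicStep

/-!
# `Balaban1983to89.B15.ComplexSpaces` — B15 pp. 190–191: the complex regularity spaces `Ũ^{(n)c}_k(X, α̃₀, α̃₁)`,
conditions (1.64)(i)–(1.69)(iii) as verbatim leaves, and the omitted descent argument of p. 191 as kernel arithmetic

CITATION HEADER (lean-in-tree rule 2026-08-18). T. Bałaban, *Large field renormalization. I. The basic step of the 𝐑
operation*, Comm. Math. Phys. **122**, 175–202 (1989) [Balaban1989LargeFieldI] (cell paper B15 = primary P15; PDF held
`paper:balaban1989-cmp122-large-field-i`, journal page = PDF page + 174; the quotations below were read off the page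
renders p016/p017 (journal pp. 190/191) and p012/p013 (pp. 186/187), not the OCR).  The paper is a manuscript UNDER
ADJUDICATION by the audit cell `pub-balaban`; nothing of it is asserted here as a fact: the `def … : Prop`/`ℝ` leaves of
Part A are verbatim transcriptions with schematic real parameters (docstring = quotation + page), and every `theorem` is
real arithmetic or bookkeeping over those leaves and over the leaves `lfFactor`, `Ineq148`, `coeff152`, `Claim129` of the
sibling `…Balaban1983to89.B15.BasicStep` (unit b01), which this file imports and does not modify — proved here, no
`sorry`, no new axioms.  Part D also quotes T. Bałaban, *Renormalization group approach to lattice gauge field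
theories. I*, Comm. Math. Phys. **109**, 249–301 (1987) [Balaban1987RG1] (cell paper B12), p. 261 (1.8)–(1.9), read
off the render p013, and Part E (v1.1) quotes T. Bałaban, *Convergent renormalization expansions for lattice gauge
theories*, Comm. Math. Phys. **119**, 243–285 (1988) [Balaban1988Convergent] (cell paper B14), p. 259 (2.24) and (2.28),
read off the render p017 (journal page = PDF page + 242).  VERSIONS: v1 (gen 25) Parts A–D; v1.1 (gen 25, same seat)
APPEND-ONLY Part E + the cross-read's tag fix (five reading-threshold theorems of Part C re-tagged `[folklore]` with the
locus named — the thresholds `11/16`, `3/4`, `ρ ≤ 2`, `4/9` are arithmetic of this reading, not printed; GAPS C-pv22g19-4),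
no v1 declaration changed; v1.2 (gen 26) DOCSTRING-ONLY fold of the delta cross-read GAPS C-b02g22-1 D-1 (Part E's
citation sentence; no declaration changed).

WHAT IS PRINTED.  p. 190: *"The space Ũ^{(n)c}_k(X, α̃₀, α̃₁), for one of the domains X in the representation (1.63), is
the set of configurations (𝕌, 𝕁) defined on X, such that 𝕌 = U′U, U has values in the group G, U′ = exp iηA′, A′ and 𝕁
have values in the complex algebra g^c. For any cube □ from the family of cubes described below there exists a gauge
transformation u defined on □∩X, and such that U^u = exp iηA, A has values in the algebra g. The configurations 𝕌,
U_{p,X}(M˙(𝕌)) = U(𝔹_p(X)∪{Γ_i^{(n)}}_{i<p}, M˙(𝕌)), 𝕁, J_{p,X}(M˙(𝕌)), U, A′, and A satisfy the following conditions: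
(i) |∂𝕌 − 1|, |∂U_{p,X}(M˙(𝕌)) − 1|, |𝕁|, |J_{p,X}(M˙(𝕌))|, |∂U − 1|, |A′|, |∇^η_U A′| < (1 − β Σ_{i=h+1}^{j} 2^{−|m−i|}
− β Σ_{q=m+1}^{k} 2^{−(q−m)}) L₀^{2max{0,m−k₀}}·[α_{0,m}η²(L^mη)^{−2}, α_{0,m}L^{−2p}(L^mL^{−p})^{−2}, α_{0,m}(L^mη)^{−3},
α_{0,m}L^{m−min{p,m}}(L^mL^{−p})^{−3}, α_{0,m}η²(L^mη)^{−2}, α_{1,m}(L^mη)^{−1}, α_{1,m}(L^mη)^{−2}] on (Ω″_m∖Ω″_{m+1})∩X for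
m = 1,…,j−1, and on (Ω″_j∖Ω_{k₀+1})∩X for m = j, p = 1,…,k"* (the display carries no visible tag on the render; it is
(1.64) by position, and `BasicStep.lfFactor` is its bracket); (1.65) *"L^mη|A|, (L^mη)²|∇^ηA| < L₀^{2max{0,m−k₀}}BCMα_{0,m}
for □ ⊂ Ω″_m, □∩Ω″^c_{m+1} ≠ ∅ if m = 1,…,j−1, and for □ ⊂ Ω″_j, □∩Ω^c_{k₀+1} ≠ ∅ if m = j, □ is of the size CML^mη"*;
(ii)/(1.66) the same seven quantities *"< (1 − β Σ_{i=h+1}^{j} 2^{−|j−i|} − β Σ_{q=j+1}^{k} 2^{−(q−j)}) L₀^{2(j−m)}·[the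
seven units with m replaced by j] on (Ω_m∖Ω_{m+1})∩X for m = k₀+1,…,j−1, j"*; (1.67) *"L^jη|A|, (L^jη)²|∇^ηA| <
L₀^{2(j−m)}BCMα_{0,j} for □ ⊂ Ω_m, □∩Ω^c_{m+1} ≠ ∅, □ is of the size CML^jη, m = k₀+1,…,j−1, j"*.  p. 191: (iii)/(1.68)
the seven quantities (here the fourth is printed *"|𝕁_{p,X}(M˙(𝕌))|"*, double-struck, where (i), (ii) print `J_{p,X}`
[sic]) *"< (1 − β Σ_{i=h+1}^{j} 2^{−|m−i|} − β Σ_{q=m+1}^{k} 2^{−(q−m)})·c[the seven units at m] on (Ω_m∖Ω_{m+1})∩X for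
m = j+1,…,k−1, and on Ω_k∩X for m = k, where c = 1 for m < k, and c = 3 for m = k"*; (1.69) *"L^mη|A|, (L^mη)²|∇^ηA| <
BCMα_{0,m} for □ ⊂ Ω_m, □∩Ω^c_{m+1} ≠ ∅ if m = j+1,…,k−1, and for □ ⊂ Ω_k if m = k, □ is of the size CML^mη. The
constant C above is a positive integer. It is usually small, because of geometric constraints on the cubes, for example
we can assume that C ≦ 2. The constant B is a fixed absolute constant, for example we can take the constant B = B₃ from
Theorem 1 [16]. … It has been written for the case where j > k₀. For j ≦ k₀ it is simpler, there are no powers of L₀ in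
the point (i), and the point (ii) is empty. … They are invariant with respect to G-valued gauge transformations. For
n = j − h = 0 the above space coincides with the space Ũ^c_k(X, α̃₀, α̃₁). They form a descending sequence for
increasing n, if β and L₀ satisfy certain conditions, for example if β ≦ 1/4 and L₀² ≦ (1/3)L. Notice that we get the
stronger restriction on L₀ because of the bounds for A′. We can improve the restriction to the previous one changing the
bounds, but it does not matter. In fact we need not only the statement that the sequence is descending, but a stronger
statement connected with the expressions we have to consider in the n + 1^{st} step. For example, we have to prove that
if 𝕌 is an element of the space Ũ^{(n+1)c}_k(X, α̃₀α̃₁) [sic], then exp iηℍ^{(n)}_k(g_jCB_j − hD̃(g_jCB_j))𝕌 is an element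
of the space Ũ^{(n)c}_k(X, α̃₀, α̃₁), and the corresponding statement for 𝕁. The proof is almost identical to the proof
of a similar statement for the configurations U_k^{(n)}, given in (44)–(52) [sic: (1.44)–(1.52)], and we will not repeat
it."*  The model it points to, pp. 186–187: (1.44) `U^{(n)}_{k,Z} = (exp iηℍ^{(n)}_{k,Z}(…)U^{(n+1)}_{k,Z})^{u^{−1}}`,
(1.45) the bound `B₃exp(−δd(y, Ω^c_{j+1}∖Z″_{j+1}))4δ′_j` for `L^iη|ℍ^{(n)}_{k,Z}|` on `B^i(y)`, the choice *"Let us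
choose a bound for these two factors in the form αβ, where an absolute constant α will be chosen later"* (after (1.47)),
(1.48) *"|U^{(n)}_{k,Z}(∂p) − 1| ≦ |U^{(n+1)}_{k,Z}(∂p) − 1|(1 + αβ2^{−(j−i)}) + αβ2^{−(j−i)}ε_i(L^{k−i}η)²"*
(= `BasicStep.Ineq148`), *"the last inequality implies (1.49) if 8α ≦ 1"* (1.50), and the top-region chain (1.51)–(1.52)
with the coefficient `(1 + β₀)(1 + αβ)L₀²/L² + 2αβ/(2−β)` (= `BasicStep.coeff152`), *"Thus taking α = 1/8 in (1.48)"*.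

WHAT THIS FILE TYPES AND PROVES.
* Part A (verbatim leaves, schematic reals — DIVERGENCE D-b01g25.1: the seven quantities, their units and the regions are
  docstring data; a clause is `quantity < factor · weight · unit`): `W164` (`L₀^{2max{0,m−k₀}}`, with `ℕ`-subtraction
  playing `max{0,·}`), `W166` (`L₀^{2(j−m)}`), `Clause164`/`Clause166`/`Clause168` (one line of (i)/(ii)/(iii)), `cConst`
  (`c = 1` for `m < k`, `c = 3` for `m = k`), `Cube165` ((1.65)/(1.67)/(1.69)), `Descends S₁ S₀ T` (the p. 191 claim
  shape: membership in the level-`n+1` space implies membership of the image under `T` in the level-`n` space;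
  `T = id` is "descending sequence" and is `BasicStep.Claim129` by `descends_id_iff`).
* Part B (exact calculus of the printed factor `lfFactor β h j m k`, all PROVED): `lfFactor_le_one`; `lfFactor_succ`
  (passing from `j` to `j+1` subtracts exactly `β2^{−|m−(j+1)|}`); the three regimes `lfFactor_succ_of_le` (`m ≤ j`:
  decrement `(β/2)2^{−(j−m)}`), `lfFactor_succ_self` (`m = j+1`: decrement `β`), `lfFactor_succ_of_ge` (`m ≥ j+2`:
  decrement `2β2^{−(m−j)}`); the diagonal closed forms `lfFactor_diag`, `lfFactor_diag_xy` (`P_n := lfFactor β h j j k =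
  1 − 3β + 2βx + βy`, `x = 2^{−(j−h)}`, `y = 2^{−(k−j)}`) and `lfFactor_diag_succ_xy` (`P_{n+1} := lfFactor β h (j+1)
  (j+1) k = 1 − 3β + βx + 2βy`); numerical instances `lfFactor_examples`.
* Part C (the omitted descent, PROVED as arithmetic UNDER AN EXPLICITLY ASSUMED ERROR MODEL — see NOT CERTIFIED): with
  each level-`n` quantity `q` tied to the same quantity `q′` of the level-`(n+1)` configuration by `Ineq148 q q′ α β s E`
  (the printed (1.48) with `i ↦ m`, `E` = the unit WITHOUT the `L₀`-power), the four types of comparisons between a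
  level-`(n+1)` clause and the level-`n` clause at the same point close as follows.  INTERIOR (`m ≤ j`, both levels rung
  `m`, `s = 2^{−(j−m)}`): `interior_coeff`, `interior_step`, `clause164_interior` — sufficient `α(P+1) ≤ 1/2`, so `α ≤ 1/4`
  (the real chain needs `8α ≤ 1` because its decrement is `βs/4`, `BasicStep.coeff150_le_coeff149_iff`; here it is `βs/2`).
  UPPER (`m = j+1`: level-`(n+1)` (ii) shell `j+1` feeds level-`n` (iii) rung `j+1`, decrement `β`): `upper_coeff`,
  `upper_step`, `clause168_upper` — sufficient `α ≤ 1/2` for any `s ≤ 1`.  DEEP (`m ≥ j+2`, both (iii), decrement `βt`,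
  `t = 2^{−(m−j−1)}`): `deep_coeff`, `deep_step`, `clause168_deep` — sufficient `2αs ≤ t`.  CREATION (the level-`(n+1)`
  diagonal factor `P_{n+1}` — (ii) shells and the new (i) rung `j+1` — feeds the level-`n` diagonal factor `P_n` — (ii)
  shells and (i) rung `j` — with the weight gaining `L₀²` and the units passing from scale `j+1` to scale `j`, i.e.
  multiplied by `ρσ′`, `ρ` = the growth ratio `α_{·,j+1}/α_{·,j}` of the unit sequence, `σ′ ∈ {L^{−1}, L^{−2}, L^{−3}}`
  the scaling of the unit, `σ′ = L^{−1}` exactly for the `|A′|` entry): `creation_coeff` — `κP_{n+1} + αβ ≤ P_n` for ALL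
  corners `x ∈ [0,1]`, `y ∈ [0,1/2]` as soon as `(1−κ)(1−3β) ≥ αβ ∧ (1−κ)(1−2β) ≥ β(α+½)` (`κ := ρσ′L₀²(1+αβ)`,
  `κ ≤ 1`); `creation_conds_printed` — under the printed `β ≤ 1/4` and the p. 187 choice `α ≤ 1/8` these hold for every
  `κ ≤ 11/16` (the second with EQUALITY at `β = 1/4, α = 1/8, κ = 11/16`); `creation_conds_quarter` (`α ≤ 1/4` needs
  `κ ≤ 5/8`); `creation_sharp` — for every `κ > 11/16` the corner `y = 1/2` (`j = k−1`), `x → 0` fails, and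
  `creation_fails_lattice` — already `κ ≥ 3/4` fails at the genuine indices `(h,j,k) = (0,4,5)`; `creation_step`,
  `clause_creation`, `clause166_creation`, `clause164_creation_top` — the assembled clause-to-clause steps.  THE `L₀`
  RESTRICTION: `kappa_printed_le` — `ρ ≤ 3/2`, `αβ ≤ 1/32`, `L₀²σ′ ≤ L₀²/L ≤ 1/3` give `κ ≤ 33/64 < 11/16`
  (`kappa_printed_lt`); `kappa_third_iff_rho_le_two` — at `αβ = 1/32`, `L₀²/L = 1/3` the creation closes for every corner
  IFF `ρ ≤ 2`; `sigma_sharp_iff` — at `ρ = 3/2` the threshold is `L₀²/L ≤ 4/9`; `half_L_unbounded` — the earlier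
  restriction `L₀ < L/2` alone leaves `L₀²/L` unbounded, which is the printed *"stronger restriction on L₀ because of the
  bounds for A′"* (unit `(L^mη)^{−1}`, `σ′ = L^{−1}`; the plaquette entries have `σ′ = L^{−2}` and see only `L₀²/L²`, as
  in the real coefficient `coeff152`: `coeff152_printed_iff`).  CUBES: `cube165_rescale` — (1.65)/(1.67)/(1.69) descend by
  pure rescaling when `L₀²ρ ≤ L` (`cube_scale_of_third`: `L₀² ≤ L/3` tolerates `ρ ≤ 3`).  `descends_comp` iterates.
* Part D (*"and the corresponding statement for 𝕁"* — the configurations are PAIRS `(𝕌, 𝕁)`, `𝕁` a free variable tied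
  to `𝕌` only on the real slice by [Balaban1987RG1] (1.8)–(1.9), p. 261, and p. 191 does not say where `𝕁` is mapped):
  `pairMap`, `Membership191 S₁ S₀ Φ r` (the claim with the 𝕁-rule `r` as a PARAMETER), `membership191_iff`; the three
  candidate rules `ruleKeep` (R0), `ruleRecompute` (R1), `ruleIncrement` (R2); `RealSliceConsistent` (the requirement
  (1.9) transported through the step) with `ruleRecompute_consistent`, `ruleIncrement_consistent`,
  `ruleKeep_consistent_iff` ((R0) is consistent iff the current is `Φ`-invariant on the real slice), and
  `affine_consistent_iff` (a consistent rule `𝕁 ↦ 𝕁 + c(𝕌)` IS the increment rule on the real slice);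
  `clause164_increment` — under (R2) a line of (1.64)(i) descends, at ANY rung and with no condition on `β, α, L₀`, as
  soon as the increment fits into the room `β2^{−|m−(j+1)|}·W·E` freed by `lfFactor_succ`.
* Part E (v1.1; toward (c) below): `alphaB14 C g x q = g·C·x^q` and `logInvSq g = log g^{−2}` ([Balaban1988Convergent]
  (2.28): `α_{·,j} = g_jC(log g_j^{−2})^{q}`); `logInvSq_pos`, `logInvSq_antitone`; `alphaB14_ratio_le` (the growth
  ratio is at most the coupling ratio `g_{j+1}/g_j` — the logarithm only helps); `coupling_monotone` and
  `coupling_ratio_le_two` (one step of (2.24) on the last domain, `1/g_j² = 1/g_{j+1}² + b`, with `b ≥ 0` resp.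
  `b·g_j² ≤ 3/4` ⇒ `g_j ≤ g_{j+1} ≤ 2g_j`); `rho_le_two_B14` (⇒ `α_{·,j+1} ≤ 2α_{·,j}`);
  `creation_closes_of_rho_le_two` (⇒ at the printed `L₀² = L/3`, `α = 1/8`, `β = 1/4` both creation conditions hold).
NOT CERTIFIED HERE (located only; census GAPS.md C-b01g25-1, which types the reading first recorded by the cell as
C-adv3-70 and re-derives every number independently): (a) the error model itself — B15 prints (1.45)–(1.48) for the REAL
configurations only; for the complex entries (in particular `|A′|`, `|𝕁|`, the `U_{p,X}(M˙𝕌)` and `J_{p,X}` entries) the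
analogue of (1.45) for `ℍ^{(n)}_k(g_jCB_j − hD̃(g_jCB_j))` (what replaces `4δ′_j`, and in which unit the additive error
comes) is not printed; (b) the region bookkeeping `Ω″_1 ⊃ ⋯ ⊃ Ω″_{j+1} ⊃ Ω_{k₀+1} ⊃ ⋯ ⊃ Ω_k` read off the printed
ranges, which pairs the clauses as INTERIOR/UPPER/DEEP/CREATION above; (c) the growth ratio `ρ` of the sequences
`α̃₀ = {α_{0,m}}`, `α̃₁ = {α_{1,m}}` (defined with the spaces `Ũ^c_k(X, α̃₀, α̃₁)` outside B15; `ρ ≤ 1 + β₀ ≤ 3/2` is the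
growth of `ε_j`, p. 192, used here only as a sample value; Part E bounds `ρ ≤ g_{j+1}/g_j ≤ 2` UNDER the reading
`α_{·,m}` = [Balaban1988Convergent] (2.28) and one step of its (2.24) with a nonnegative coefficient `b`, `b·g_j² ≤ 3/4` —
the identification, the sign/size of `β_j` ([Balaban1987RG1] (0.20)–(0.23)) and the flow control `0 < g_k ≤ γ < 1`
([Balaban1987RG1] Theorem 2, unproved in print) remain HYPOTHESES); (d) for the cube conditions, that `U`, `A`, `u` are
unchanged under `𝕌 ↦ exp(iηℍ)𝕌 = (exp(iηℍ)U′)U` and that a level-`n` cube of size `CML^jη` lies in a level-`(n+1)` cube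
of size `CML^{j+1}η` of the admissible family; (e) which 𝕁-rule B15 means, and the bound on the increment `J(exp iηℍ𝕌) − J(𝕌)` that
the increment rule consumes — a second-derivative quantity of `ℍ^{(n)}_k`, while (1.45) prints `ℍ` and `∇ℍ` only (the
cell's analysis is GAPS C-adv3-72; nothing of it is used here as a fact).  Unit `b2b-balaban-b01`
(fallback seat, PHASE-2 row P15), generation 25.  Census: GAPS.md C-b01g25-1; DIVERGENCE.md D-b01g25.1.
-/

open scoped BigOperators
open Finset

namespace Literature.MathematicalPhysics.QuantumFieldTheory.Balaban1983to89.B15.ComplexSpaces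

open BasicStep (lfFactor Ineq148 coeff152 Claim129)

/-! ## Part A. Verbatim leaves of (1.64)(i)–(1.69)(iii), pp. 190–191 (schematic reals — DIVERGENCE D-b01g25.1). -/

section Leaves

/-- (1.64)(i)/(1.65) p. 190: the weight *"L₀^{2max{0,m−k₀}}"* — natural-number subtraction `m − k₀` IS `max{0, m−k₀}`.
[cite: Balaban1989LargeFieldI, (1.64) p.190] -/
noncomputable def W164 (L₀ : ℝ) (m k₀ : ℕ) : ℝ := L₀ ^ (2 * (m - k₀))

/-- (1.66)(ii)/(1.67) p. 190: the weight *"L₀^{2(j−m)}"* (`m = k₀+1,…,j`). [cite: Balaban1989LargeFieldI, (1.66) p.190] -/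
noncomputable def W166 (L₀ : ℝ) (j m : ℕ) : ℝ := L₀ ^ (2 * (j - m))

/-- **(1.64)(i)** p. 190, one line, verbatim: *"|∂𝕌 − 1|, |∂U_{p,X}(M˙(𝕌)) − 1|, |𝕁|, |J_{p,X}(M˙(𝕌))|, |∂U − 1|,
|A′|, |∇^η_U A′| < (1 − β Σ_{i=h+1}^{j} 2^{−|m−i|} − β Σ_{q=m+1}^{k} 2^{−(q−m)}) L₀^{2max{0,m−k₀}}·[α_{0,m}η²(L^mη)^{−2},
α_{0,m}L^{−2p}(L^mL^{−p})^{−2}, α_{0,m}(L^mη)^{−3}, α_{0,m}L^{m−min{p,m}}(L^mL^{−p})^{−3}, α_{0,m}η²(L^mη)^{−2},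
α_{1,m}(L^mη)^{−1}, α_{1,m}(L^mη)^{−2}] on (Ω″_m∖Ω″_{m+1})∩X for m = 1,…,j−1, and on (Ω″_j∖Ω_{k₀+1})∩X for m = j,
p = 1,…,k"*.  Schematic: `q` = one of the seven quantities at a point of the rung-`m` region, `W` = the weight
(`W164 L₀ m k₀` in (i)), `E` = the matching unit of the printed list; the factor is `BasicStep.lfFactor β h j m k`.
[cite: Balaban1989LargeFieldI, (1.64) p.190] -/
def Clause164 (q β : ℝ) (h j m k : ℕ) (W E : ℝ) : Prop := q < lfFactor β h j m k * W * E

/-- **(1.66)(ii)** p. 190, one line, verbatim: the seven quantities *"< (1 − β Σ_{i=h+1}^{j} 2^{−|j−i|} −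
β Σ_{q=j+1}^{k} 2^{−(q−j)}) L₀^{2(j−m)}·[α_{0,j}η²(L^jη)^{−2}, α_{0,j}L^{−2p}(L^jL^{−p})^{−2}, α_{0,j}(L^jη)^{−3},
α_{0,j}L^{j−min{p,j}}(L^jL^{−p})^{−3}, α_{0,j}η²(L^jη)^{−2}, α_{1,j}(L^jη)^{−1}, α_{1,j}(L^jη)^{−2}] on (Ω_m∖Ω_{m+1})∩X
for m = k₀+1,…,j−1, j"* — the factor is the DIAGONAL `lfFactor β h j j k`, the weight `W166 L₀ j m`, the units sit at
scale `j` for every shell `m`. [cite: Balaban1989LargeFieldI, (1.66) p.190] -/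
def Clause166 (q β : ℝ) (h j m k : ℕ) (L₀ E : ℝ) : Prop := Clause164 q β h j j k (W166 L₀ j m) E

/-- p. 191, after (1.68): *"where c = 1 for m < k, and c = 3 for m = k"*. [cite: Balaban1989LargeFieldI, (1.68) p.191] -/
noncomputable def cConst (m k : ℕ) : ℝ := if m < k then 1 else 3

/-- **(1.68)(iii)** p. 191, one line, verbatim: *"|∂𝕌 − 1|, |∂U_{p,X}(M˙(𝕌)) − 1|, |𝕁|, |𝕁_{p,X}(M˙(𝕌))|,
|∂U − 1|, |A′|, |∇^η_U A′| < (1 − β Σ_{i=h+1}^{j} 2^{−|m−i|} − β Σ_{q=m+1}^{k} 2^{−(q−m)})·c[α_{0,m}η²(L^mη)^{−2}, …,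
α_{1,m}(L^mη)^{−2}] on (Ω_m∖Ω_{m+1})∩X for m = j+1,…,k−1, and on Ω_k∩X for m = k"* — NO power of `L₀`; `c` is
`cConst m k`. [cite: Balaban1989LargeFieldI, (1.68) p.191] -/
def Clause168 (q β : ℝ) (h j m k : ℕ) (c E : ℝ) : Prop := Clause164 q β h j m k c E

/-- **(1.65)/(1.67)/(1.69)** pp. 190–191, verbatim (1.65): *"L^mη|A|, (L^mη)²|∇^ηA| < L₀^{2max{0,m−k₀}}BCMα_{0,m}
for □ ⊂ Ω″_m, □∩Ω″^c_{m+1} ≠ ∅ …, □ is of the size CML^mη"*; (1.67) has the weight `L₀^{2(j−m)}`, the scale `L^jη`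
and `α_{0,j}`; (1.69) has no weight.  Schematic: `a = L^·η|A|`, `da = (L^·η)²|∇^ηA|` (sup over the cube in the gauge
`u`), `W` = the weight. [cite: Balaban1989LargeFieldI, (1.65) p.190] -/
def Cube165 (a da W B C M α₀ : ℝ) : Prop := a < W * (B * C * M * α₀) ∧ da < W * (B * C * M * α₀)

/-- p. 191, the omitted claim, verbatim: *"we have to prove that if 𝕌 is an element of the space Ũ^{(n+1)c}_k(X, α̃₀α̃₁)
[sic], then exp iηℍ^{(n)}_k(g_jCB_j − hD̃(g_jCB_j))𝕌 is an element of the space Ũ^{(n)c}_k(X, α̃₀, α̃₁) … The proof is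
almost identical to the proof of a similar statement for the configurations U_k^{(n)}, given in (44)–(52) [sic], and we
will not repeat it"*.  Schematic shape: `S₁` = membership in the level-`(n+1)` space, `S₀` = membership in the level-`n`
space, `T` = the map `𝕌 ↦ exp iηℍ^{(n)}_k(…)𝕌` (`T = id`: "They form a descending sequence for increasing n").
[cite: Balaban1989LargeFieldI, p.191] -/
def Descends {C : Type*} (S₁ S₀ : C → Prop) (T : C → C) : Prop := ∀ U, S₁ U → S₀ (T U)

/-- With `T = id` the claim is the inclusion of the spaces, i.e. `BasicStep.Claim129`. Bookkeeping. [folklore] -/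
theorem descends_id_iff {C : Type*} (S₁ S₀ : C → Prop) : Descends S₁ S₀ id ↔ Claim129 S₁ S₀ := Iff.rfl

/-- Descents compose (level `n+2 → n+1 → n`). Bookkeeping. [folklore] -/
theorem descends_comp {C : Type*} {S₂ S₁ S₀ : C → Prop} {T₁ T₀ : C → C} (h₁ : Descends S₂ S₁ T₁)
    (h₀ : Descends S₁ S₀ T₀) : Descends S₂ S₀ (T₀ ∘ T₁) := fun U hU => h₀ _ (h₁ U hU)

/-- `W164` is `1` for `m ≤ k₀` (p. 191: *"For j ≦ k₀ … there are no powers of L₀ in the point (i)"*). [cite: Balaban1989LargeFieldI, p.191] -/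
theorem W164_of_le (L₀ : ℝ) {m k₀ : ℕ} (h : m ≤ k₀) : W164 L₀ m k₀ = 1 := by
  unfold W164
  rw [Nat.sub_eq_zero_of_le h, mul_zero, pow_zero]

/-- The weights are `≥ 1` for `L₀ ≥ 1`. [folklore] -/
theorem one_le_W164 {L₀ : ℝ} (hL₀ : 1 ≤ L₀) (m k₀ : ℕ) : 1 ≤ W164 L₀ m k₀ := one_le_pow₀ hL₀

/-- The weights are `≥ 1` for `L₀ ≥ 1`. [folklore] -/
theorem one_le_W166 {L₀ : ℝ} (hL₀ : 1 ≤ L₀) (j m : ℕ) : 1 ≤ W166 L₀ j m := one_le_pow₀ hL₀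

/-- Passing from `j` to `j+1` multiplies the (ii) weight by `L₀²` (`m ≤ j`). [folklore] -/
theorem W166_succ (L₀ : ℝ) {j m : ℕ} (hm : m ≤ j) : W166 L₀ (j + 1) m = L₀ ^ 2 * W166 L₀ j m := by
  unfold W166
  rw [← pow_add]
  congr 1
  omega

/-- Passing from `j` to `j+1` multiplies the (i) weight by at most `L₀²` (by exactly `L₀²` if `j ≥ k₀`, by `1` if
`j < k₀`), `L₀ ≥ 1`. [folklore] -/
theorem W164_succ_le {L₀ : ℝ} (hL₀ : 1 ≤ L₀) (j k₀ : ℕ) : W164 L₀ (j + 1) k₀ ≤ L₀ ^ 2 * W164 L₀ j k₀ := by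
  unfold W164
  rcases Nat.lt_or_ge j k₀ with hlt | hge
  · have e1 : 2 * (j + 1 - k₀) = 0 := by omega
    have e2 : 2 * (j - k₀) = 0 := by omega
    rw [e1, e2, pow_zero, mul_one]
    nlinarith
  · have e : 2 * (j + 1 - k₀) = 2 + 2 * (j - k₀) := by omega
    rw [e, pow_add]

/-- `1 ≤ c`. [folklore] -/
theorem one_le_cConst (m k : ℕ) : 1 ≤ cConst m k := by
  unfold cConst; split_ifs <;> norm_num

end Leaves

/-! ## Part B. Exact calculus of the printed factor `lfFactor β h j m k` (all proved). -/

section Factor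

/-- The factor is `≤ 1` for `β ≥ 0`. [cite: Balaban1989LargeFieldI, (1.64) p.190] -/
theorem lfFactor_le_one {β : ℝ} (hβ : 0 ≤ β) (h j m k : ℕ) : lfFactor β h j m k ≤ 1 := by
  unfold lfFactor
  have h1 : 0 ≤ ∑ n ∈ Finset.range (j - h), (1 / 2 : ℝ) ^ Int.natAbs ((m : ℤ) - (h + 1 + n : ℕ)) :=
    Finset.sum_nonneg (fun n _ => by positivity)
  have h2 : 0 ≤ ∑ n ∈ Finset.range (k - m), (1 / 2 : ℝ) ^ (n + 1) :=
    Finset.sum_nonneg (fun n _ => by positivity)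
  nlinarith [mul_nonneg hβ h1, mul_nonneg hβ h2]

/-- `Σ_{n<N} 2^{−(n+1)} = 1 − 2^{−N}` (the second printed sum in closed form). [folklore] -/
theorem sum_half_pow_succ_eq (N : ℕ) : ∑ n ∈ Finset.range N, (1 / 2 : ℝ) ^ (n + 1) = 1 - (1 / 2) ^ N := by
  induction N with
  | zero => simp
  | succ N ih => rw [Finset.sum_range_succ, ih, pow_succ]; ring

/-- `Σ_{n<N} 2^{−n} = 2 − 2·2^{−N}`. [folklore] -/
theorem sum_half_pow_eq (N : ℕ) : ∑ n ∈ Finset.range N, (1 / 2 : ℝ) ^ n = 2 - 2 * (1 / 2) ^ N := by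
  induction N with
  | zero => simp
  | succ N ih => rw [Finset.sum_range_succ, ih, pow_succ]; ring

/-- The first printed sum on the diagonal `m = j`: `Σ_{i=h+1}^{j} 2^{−|j−i|} = 2 − 2·2^{−(j−h)}`. [cite: Balaban1989LargeFieldI, (1.66) p.190] -/
theorem sum_first_diag (h j : ℕ) :
    ∑ n ∈ Finset.range (j - h), (1 / 2 : ℝ) ^ Int.natAbs ((j : ℤ) - (h + 1 + n : ℕ))
      = 2 - 2 * (1 / 2 : ℝ) ^ (j - h) := by
  have step : ∑ n ∈ Finset.range (j - h), (1 / 2 : ℝ) ^ Int.natAbs ((j : ℤ) - (h + 1 + n : ℕ))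
      = ∑ n ∈ Finset.range (j - h), (1 / 2 : ℝ) ^ (j - h - 1 - n) := by
    apply Finset.sum_congr rfl
    intro n hn
    rw [Finset.mem_range] at hn
    congr 1
    omega
  have hrefl := Finset.sum_range_reflect (fun l => (1 / 2 : ℝ) ^ l) (j - h)
  rw [step, hrefl, sum_half_pow_eq]

/-- **The step `j ↦ j+1` of the factor**, exact: `lfFactor β h (j+1) m k = lfFactor β h j m k − β2^{−|m−(j+1)|}`
(`h ≤ j`; the first sum acquires the term `i = j+1`, the second is unchanged). [cite: Balaban1989LargeFieldI, (1.64) p.190] -/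
theorem lfFactor_succ (β : ℝ) {h j : ℕ} (hhj : h ≤ j) (m k : ℕ) :
    lfFactor β h (j + 1) m k = lfFactor β h j m k - β * (1 / 2 : ℝ) ^ Int.natAbs ((m : ℤ) - (j + 1 : ℕ)) := by
  unfold lfFactor
  have e1 : j + 1 - h = (j - h) + 1 := by omega
  have e2 : (h + 1 + (j - h) : ℕ) = j + 1 := by omega
  rw [e1, Finset.sum_range_succ, e2]
  ring

/-- INTERIOR regime `m ≤ j`: the decrement is `(β/2)·2^{−(j−m)}` (half the error scale `s = 2^{−(j−m)}` of (1.48) with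
`i ↦ m`). [cite: Balaban1989LargeFieldI, (1.64) p.190] -/
theorem lfFactor_succ_of_le (β : ℝ) {h j m : ℕ} (hhj : h ≤ j) (hm : m ≤ j) (k : ℕ) :
    lfFactor β h (j + 1) m k = lfFactor β h j m k - β / 2 * (1 / 2 : ℝ) ^ (j - m) := by
  rw [lfFactor_succ β hhj]
  have e : Int.natAbs ((m : ℤ) - (j + 1 : ℕ)) = (j - m) + 1 := by omega
  rw [e, pow_succ]
  ring

/-- UPPER regime `m = j+1`: the decrement is `β`. [cite: Balaban1989LargeFieldI, (1.68) p.191] -/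
theorem lfFactor_succ_self (β : ℝ) {h j : ℕ} (hhj : h ≤ j) (k : ℕ) :
    lfFactor β h (j + 1) (j + 1) k = lfFactor β h j (j + 1) k - β := by
  rw [lfFactor_succ β hhj]
  simp

/-- DEEP regime `m ≥ j+2`: the decrement is `β2^{−(m−j−1)} = 2β·2^{−(m−j)}`. [cite: Balaban1989LargeFieldI, (1.68) p.191] -/
theorem lfFactor_succ_of_ge (β : ℝ) {h j m : ℕ} (hhj : h ≤ j) (hm : j + 2 ≤ m) (k : ℕ) :
    lfFactor β h (j + 1) m k = lfFactor β h j m k - 2 * β * (1 / 2 : ℝ) ^ (m - j) := by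
  rw [lfFactor_succ β hhj]
  have e : Int.natAbs ((m : ℤ) - (j + 1 : ℕ)) = m - j - 1 := by omega
  have e' : (1 / 2 : ℝ) ^ (m - j) = (1 / 2) ^ (m - j - 1) * (1 / 2) := by
    rw [← pow_succ]; congr 1; omega
  rw [e, e']
  ring

/-- The DIAGONAL factor in closed form: `lfFactor β h j j k = 1 − β(2 − 2·2^{−(j−h)}) − β(1 − 2^{−(k−j)})` (the factor
of every (ii) line and of the (i) line `m = j`). [cite: Balaban1989LargeFieldI, (1.66) p.190] -/
theorem lfFactor_diag (β : ℝ) (h j k : ℕ) :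
    lfFactor β h j j k = 1 - β * (2 - 2 * (1 / 2 : ℝ) ^ (j - h)) - β * (1 - (1 / 2 : ℝ) ^ (k - j)) := by
  unfold lfFactor
  rw [sum_first_diag, sum_half_pow_succ_eq]

/-- `P_n = 1 − 3β + 2βx + βy` with `x = 2^{−(j−h)} = 2^{−n}`, `y = 2^{−(k−j)}`. [cite: Balaban1989LargeFieldI, (1.66) p.190] -/
theorem lfFactor_diag_xy (β : ℝ) (h j k : ℕ) :
    lfFactor β h j j k = 1 - 3 * β + 2 * β * (1 / 2 : ℝ) ^ (j - h) + β * (1 / 2 : ℝ) ^ (k - j) := by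
  rw [lfFactor_diag]; ring

/-- `P_{n+1} = 1 − 3β + βx + 2βy` in the SAME `x = 2^{−(j−h)}`, `y = 2^{−(k−j)}` (`h ≤ j`, `j+1 ≤ k`).
[cite: Balaban1989LargeFieldI, (1.66) p.190] -/
theorem lfFactor_diag_succ_xy (β : ℝ) {h j k : ℕ} (hhj : h ≤ j) (hjk : j + 1 ≤ k) :
    lfFactor β h (j + 1) (j + 1) k
      = 1 - 3 * β + β * (1 / 2 : ℝ) ^ (j - h) + 2 * β * (1 / 2 : ℝ) ^ (k - j) := by
  rw [lfFactor_diag]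
  have e1 : j + 1 - h = (j - h) + 1 := by omega
  have e2 : k - j = (k - (j + 1)) + 1 := by omega
  rw [e1, e2, pow_succ, pow_succ]
  ring

/-- Numerical instances (`β = 1/4`): `(h,j,m,k) = (0,4,2,5) ↦ 7/32` (also `BasicStep.lfFactor_witness`), its successor
`(0,5,2,5) ↦ 3/16 = 7/32 − (1/8)·2^{−2}`; the diagonal values `(0,4,4,5) ↦ 13/32 = P_n` and `(0,5,5,5) ↦ 33/64 =
P_{n+1}` at `x = 1/16`, `y = 1/2`. [cite: Balaban1989LargeFieldI, (1.64) p.190] -/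
theorem lfFactor_examples :
    lfFactor (1 / 4) 0 4 2 5 = 7 / 32 ∧ lfFactor (1 / 4) 0 5 2 5 = 3 / 16 ∧
      lfFactor (1 / 4) 0 4 4 5 = 13 / 32 ∧ lfFactor (1 / 4) 0 5 5 5 = 33 / 64 := by
  refine ⟨?_, ?_, ?_, ?_⟩ <;> (simp [lfFactor, Finset.sum_range_succ]; norm_num)

end Factor

/-! ## Part C. The omitted descent (p. 191) as arithmetic, under the (1.48)-type error model `Ineq148`. -/

section Descent

/-- INTERIOR algebra: `(P − βs/2)(1 + αβs) + αβs ≤ P` as soon as `α(P+1) ≤ 1/2` (`α, β, s ≥ 0`, `P ≤ 1`; no lower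
bound on `P` is needed). [cite: Balaban1989LargeFieldI, (1.50) p.187] -/
theorem interior_coeff {P α β s : ℝ} (hα0 : 0 ≤ α) (hβ : 0 ≤ β) (hs : 0 ≤ s) (hαP : α * (P + 1) ≤ 1 / 2) :
    (P - β * s / 2) * (1 + α * β * s) + α * β * s ≤ P := by
  have hbs : 0 ≤ β * s := mul_nonneg hβ hs
  have h1 : 0 ≤ β * s * (1 / 2 - α * (P + 1)) := mul_nonneg hbs (by linarith)
  have h2 : 0 ≤ α * (β * s) * (β * s) / 2 := by positivity
  nlinarith [h1, h2]

/-- INTERIOR step (schematic): from (1.48) with scale `s`, the level-`(n+1)` clause with factor `P − βs/2`, the same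
weight `W ≥ 1` and unit `E ≥ 0`, the level-`n` clause with factor `P` follows if `α(P+1) ≤ 1/2`. [cite: Balaban1989LargeFieldI, (1.50) p.187] -/
theorem interior_step {q q' α β s P W E : ℝ} (hα0 : 0 ≤ α) (hβ : 0 ≤ β) (hs : 0 ≤ s)
    (hαP : α * (P + 1) ≤ 1 / 2) (hW : 1 ≤ W) (hE : 0 ≤ E) (h148 : Ineq148 q q' α β s E)
    (hn1 : q' < (P - β * s / 2) * W * E) : q < P * W * E := by
  unfold Ineq148 at h148
  have hpos : 0 < 1 + α * β * s := by positivity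
  have h1 : q' * (1 + α * β * s) < (P - β * s / 2) * W * E * (1 + α * β * s) :=
    mul_lt_mul_of_pos_right hn1 hpos
  have hWE : 0 ≤ W * E := mul_nonneg (by linarith) hE
  have hαβs : 0 ≤ α * β * s := by positivity
  have h2 : α * β * s * E ≤ α * β * s * (W * E) := by
    have hEW : E ≤ W * E := by nlinarith
    exact mul_le_mul_of_nonneg_left hEW hαβs
  have hc := interior_coeff hα0 hβ hs hαP
  calc q ≤ q' * (1 + α * β * s) + α * β * s * E := h148
    _ < (P - β * s / 2) * W * E * (1 + α * β * s) + α * β * s * (W * E) := by linarith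
    _ = ((P - β * s / 2) * (1 + α * β * s) + α * β * s) * (W * E) := by ring
    _ ≤ P * (W * E) := mul_le_mul_of_nonneg_right hc hWE
    _ = P * W * E := by ring

/-- **INTERIOR STEP on (1.64)(i)**, `m ≤ j` (both levels rung `m`, same weight, same unit; the level-`(n+1)` factor is
`lfFactor β h (j+1) m k = lfFactor β h j m k − (β/2)2^{−(j−m)}`): with the error model (1.48) at scale `s = 2^{−(j−m)}`
the level-`n` line follows for every `0 ≤ α ≤ 1/4`, `β ≥ 0`.  (The real chain (1.49)/(1.50) needs `α ≤ 1/8` because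
its decrement is `βs/4`.) [cite: Balaban1989LargeFieldI, p.191] -/
theorem clause164_interior {q q' α β W E : ℝ} {h j m k : ℕ} (hhj : h ≤ j) (hm : m ≤ j) (hα0 : 0 ≤ α)
    (hα : α ≤ 1 / 4) (hβ : 0 ≤ β) (hW : 1 ≤ W) (hE : 0 ≤ E)
    (h148 : Ineq148 q q' α β ((1 / 2 : ℝ) ^ (j - m)) E) (hn1 : Clause164 q' β h (j + 1) m k W E) :
    Clause164 q β h j m k W E := by
  unfold Clause164 at hn1 ⊢
  rw [lfFactor_succ_of_le β hhj hm] at hn1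
  have hP : lfFactor β h j m k ≤ 1 := lfFactor_le_one hβ h j m k
  have e : lfFactor β h j m k - β / 2 * (1 / 2 : ℝ) ^ (j - m)
      = lfFactor β h j m k - β * (1 / 2 : ℝ) ^ (j - m) / 2 := by ring
  rw [e] at hn1
  have hαP : α * (lfFactor β h j m k + 1) ≤ 1 / 2 := by nlinarith
  exact interior_step hα0 hβ (by positivity) hαP hW hE h148 hn1

/-- UPPER algebra: `P(1 + αβs) + αβs ≤ P + β` as soon as `α ≤ 1/2` (`0 ≤ s ≤ 1`, `P ≤ 1`, `α, β ≥ 0`).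
[cite: Balaban1989LargeFieldI, p.191] -/
theorem upper_coeff {P α β s : ℝ} (hα0 : 0 ≤ α) (hα : α ≤ 1 / 2) (hβ : 0 ≤ β) (hs0 : 0 ≤ s) (hs : s ≤ 1)
    (hP : P ≤ 1) : P * (1 + α * β * s) + α * β * s ≤ P + β := by
  have hαs : α * s ≤ 1 / 2 := by nlinarith [mul_le_mul_of_nonneg_left hs hα0]
  have h1 : 0 ≤ β * (1 - 2 * (α * s)) := mul_nonneg hβ (by linarith)
  have h2 : 0 ≤ β * (α * s) * (1 - P) := mul_nonneg (mul_nonneg hβ (mul_nonneg hα0 hs0)) (by linarith)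
  nlinarith [h1, h2]

/-- UPPER step (schematic): level `n+1` gives `q′ < (P − β)·E` (shell `j+1` of (ii): weight `L₀⁰ = 1`, units at scale
`j+1`), the error model has some scale `s ≤ 1`, and the level-`n` (iii) line at rung `j+1` has factor `P` and the
extra constant `c ≥ 1`: it follows for `α ≤ 1/2` (`q ≥ 0`, an absolute value). [cite: Balaban1989LargeFieldI, p.191] -/
theorem upper_step {q q' α β s P c E : ℝ} (hq : 0 ≤ q) (hα0 : 0 ≤ α) (hα : α ≤ 1 / 2) (hβ : 0 ≤ β)
    (hs0 : 0 ≤ s) (hs : s ≤ 1) (hP : P ≤ 1) (hc : 1 ≤ c) (hE : 0 ≤ E) (h148 : Ineq148 q q' α β s E)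
    (hn1 : q' < (P - β) * E) : q < P * c * E := by
  unfold Ineq148 at h148
  have hpos : 0 < 1 + α * β * s := by positivity
  have h1 := mul_lt_mul_of_pos_right hn1 hpos
  have hcoef := upper_coeff hα0 hα hβ hs0 hs (show P - β ≤ 1 by linarith)
  have h2 : q < P * E := by
    calc q ≤ q' * (1 + α * β * s) + α * β * s * E := h148
      _ < (P - β) * E * (1 + α * β * s) + α * β * s * E := by linarith
      _ = ((P - β) * (1 + α * β * s) + α * β * s) * E := by ring
      _ ≤ ((P - β) + β) * E := mul_le_mul_of_nonneg_right hcoef hE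
      _ = P * E := by ring
  have h3 : 0 < P * E := lt_of_le_of_lt hq h2
  calc q < P * E := h2
    _ = P * E * 1 := by ring
    _ ≤ P * E * c := mul_le_mul_of_nonneg_left hc h3.le
    _ = P * c * E := by ring

/-- **UPPER STEP (ii)@`n+1` ⇒ (iii)@`n`**, `m = j+1`: the level-`(n+1)` shell `j+1` of (1.66) (factor `lfFactor β h (j+1)
(j+1) k = lfFactor β h j (j+1) k − β`, weight `W166 L₀ (j+1) (j+1) = 1`, units at scale `j+1` = the rung-`(j+1)` units
of (iii)) implies the level-`n` (1.68) line at rung `j+1` for any error scale `s ≤ 1` and `α ≤ 1/2`. [cite: Balaban1989LargeFieldI, p.191] -/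
theorem clause168_upper {q q' α β s c L₀ E : ℝ} {h j k : ℕ} (hhj : h ≤ j) (hq : 0 ≤ q) (hα0 : 0 ≤ α)
    (hα : α ≤ 1 / 2) (hβ : 0 ≤ β) (hs0 : 0 ≤ s) (hs : s ≤ 1) (hc : 1 ≤ c) (hE : 0 ≤ E)
    (h148 : Ineq148 q q' α β s E) (hn1 : Clause166 q' β h (j + 1) (j + 1) k L₀ E) :
    Clause168 q β h j (j + 1) k c E := by
  unfold Clause166 Clause164 W166 at hn1
  rw [Nat.sub_self, mul_zero, pow_zero, mul_one, lfFactor_succ_self β hhj] at hn1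
  unfold Clause168 Clause164
  exact upper_step hq hα0 hα hβ hs0 hs (lfFactor_le_one hβ h j (j + 1) k) hc hE h148 hn1

/-- DEEP algebra: `(P − βt)c(1 + αβs) + αβs ≤ Pc` as soon as `2αs ≤ t` (`α, β, s ≥ 0`, `P ≤ 1`, `c ≥ 1`).
[cite: Balaban1989LargeFieldI, p.191] -/
theorem deep_coeff {P α β s t c : ℝ} (hα0 : 0 ≤ α) (hβ : 0 ≤ β) (hs0 : 0 ≤ s) (hP : P ≤ 1) (hc : 1 ≤ c)
    (hst : 2 * α * s ≤ t) : (P - β * t) * c * (1 + α * β * s) + α * β * s ≤ P * c := by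
  have hαs : 0 ≤ α * s := mul_nonneg hα0 hs0
  have ht : 0 ≤ t := by linarith
  have hc0 : (0 : ℝ) ≤ c := by linarith
  have h1 : 0 ≤ (t - 2 * α * s) * c := mul_nonneg (by linarith) hc0
  have h2 : 0 ≤ α * s * c * (1 - P) := mul_nonneg (mul_nonneg hαs hc0) (by linarith)
  have h3 : 0 ≤ α * s * (c - 1) := mul_nonneg hαs (by linarith)
  have h4 : 0 ≤ α * β * s * t * c := mul_nonneg (mul_nonneg (mul_nonneg (mul_nonneg hα0 hβ) hs0) ht) hc0
  have key : P * c - ((P - β * t) * c * (1 + α * β * s) + α * β * s)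
      = β * ((t - 2 * α * s) * c + α * s * c * (1 - P) + α * s * (c - 1) + α * β * s * t * c) := by ring
  have h5 : 0 ≤ (t - 2 * α * s) * c + α * s * c * (1 - P) + α * s * (c - 1) + α * β * s * t * c := by
    linarith
  have h6 := mul_nonneg hβ h5
  linarith [key]

/-- DEEP step (schematic): level `n+1` gives `q′ < (P − βt)·c·E` (same rung `m ≥ j+2` of (iii), same `c`, same units),
the error model has scale `s` with `2αs ≤ t`: the level-`n` line `q < P·c·E` follows. [cite: Balaban1989LargeFieldI, p.191] -/
theorem deep_step {q q' α β s t P c E : ℝ} (hα0 : 0 ≤ α) (hβ : 0 ≤ β) (hs0 : 0 ≤ s) (hP : P ≤ 1) (hc : 1 ≤ c)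
    (hst : 2 * α * s ≤ t) (hE : 0 ≤ E) (h148 : Ineq148 q q' α β s E) (hn1 : q' < (P - β * t) * c * E) :
    q < P * c * E := by
  unfold Ineq148 at h148
  have hpos : 0 < 1 + α * β * s := by positivity
  have h1 := mul_lt_mul_of_pos_right hn1 hpos
  have hcoef := deep_coeff hα0 hβ hs0 hP hc hst
  calc q ≤ q' * (1 + α * β * s) + α * β * s * E := h148
    _ < (P - β * t) * c * E * (1 + α * β * s) + α * β * s * E := by linarith
    _ = ((P - β * t) * c * (1 + α * β * s) + α * β * s) * E := by ring
    _ ≤ P * c * E := mul_le_mul_of_nonneg_right hcoef hE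

/-- **DEEP STEP on (1.68)(iii)**, `m ≥ j+2` (both levels rung `m`; the level-`(n+1)` factor is `lfFactor β h j m k −
2β2^{−(m−j)}`): with the error model at a scale `s` with `αs ≤ 2^{−(m−j)}` (e.g. `s = 2^{−(m−j)}`, the decay of `ℍ^{(n)}`
into `Ω_{j+1}`, and `α ≤ 1`) the level-`n` line follows. [cite: Balaban1989LargeFieldI, p.191] -/
theorem clause168_deep {q q' α β s c E : ℝ} {h j m k : ℕ} (hhj : h ≤ j) (hm : j + 2 ≤ m) (hα0 : 0 ≤ α)
    (hβ : 0 ≤ β) (hs0 : 0 ≤ s) (hαs : α * s ≤ (1 / 2 : ℝ) ^ (m - j)) (hc : 1 ≤ c) (hE : 0 ≤ E)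
    (h148 : Ineq148 q q' α β s E) (hn1 : Clause168 q' β h (j + 1) m k c E) :
    Clause168 q β h j m k c E := by
  unfold Clause168 Clause164 at hn1 ⊢
  rw [lfFactor_succ_of_ge β hhj hm] at hn1
  have e : lfFactor β h j m k - 2 * β * (1 / 2 : ℝ) ^ (m - j)
      = lfFactor β h j m k - β * (2 * (1 / 2 : ℝ) ^ (m - j)) := by ring
  rw [e] at hn1
  exact deep_step hα0 hβ hs0 (lfFactor_le_one hβ h j m k) hc (by linarith) hE h148 hn1

/-- **CREATION algebra** (the level-`(n+1)` diagonal factor feeding the level-`n` diagonal factor): with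
`P_n = 1 − 3β + 2βx + βy`, `P_{n+1} = 1 − 3β + βx + 2βy` (`lfFactor_diag_xy`, `lfFactor_diag_succ_xy`),
`κP_{n+1} + αβ ≤ P_n` holds for ALL `x ≥ 0`, `0 ≤ y ≤ 1/2` as soon as `κ ≤ 1`, `(1−κ)(1−3β) ≥ αβ` and
`(1−κ)(1−2β) ≥ β(α + ½)` (`β ≥ 0`).  (`P_n − κP_{n+1} − αβ = (1−κ)(1−3β) − αβ + βx(2−κ) + βy(1−2κ)`: for `κ ≤ 1/2`
the first condition is the binding corner `x = y = 0`, for `κ > 1/2` the corner `x = 0, y = 1/2` gives the second.)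
[cite: Balaban1989LargeFieldI, p.191] -/
theorem creation_coeff {α β κ x y : ℝ} (hβ : 0 ≤ β) (hx : 0 ≤ x) (hy0 : 0 ≤ y) (hy : y ≤ 1 / 2) (hκ : κ ≤ 1)
    (c1 : α * β ≤ (1 - κ) * (1 - 3 * β)) (c2 : β * (α + 1 / 2) ≤ (1 - κ) * (1 - 2 * β)) :
    κ * (1 - 3 * β + β * x + 2 * β * y) + α * β ≤ 1 - 3 * β + 2 * β * x + β * y := by
  have hx' : 0 ≤ β * x * (2 - κ) := mul_nonneg (mul_nonneg hβ hx) (by linarith)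
  rcases le_or_gt 0 (1 - 2 * κ) with h | h
  · have hy' : 0 ≤ β * y * (1 - 2 * κ) := mul_nonneg (mul_nonneg hβ hy0) h
    nlinarith [hx', hy']
  · have hy' : 0 ≤ β * (2 * κ - 1) * (1 / 2 - y) :=
      mul_nonneg (mul_nonneg hβ (by linarith)) (by linarith)
    nlinarith [hx', hy']

/-- **The printed sufficient condition**: under *"β ≦ 1/4"* (p. 191) and the p. 187 choice `α ≤ 1/8` both creation
conditions hold for every `κ ≤ 11/16` (the second with EQUALITY at `β = 1/4`, `α = 1/8`, `κ = 11/16`: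
`(5/16)(1/2) = (1/4)(5/8) = 5/32`). [cite: Balaban1989LargeFieldI, p.191] -/
theorem creation_conds_printed {α β κ : ℝ} (hα0 : 0 ≤ α) (hα : α ≤ 1 / 8) (hβ0 : 0 ≤ β) (hβ : β ≤ 1 / 4)
    (hκ : κ ≤ 11 / 16) :
    α * β ≤ (1 - κ) * (1 - 3 * β) ∧ β * (α + 1 / 2) ≤ (1 - κ) * (1 - 2 * β) := by
  constructor
  · have h1 : α * β ≤ 1 / 8 * (1 / 4) := mul_le_mul hα hβ hβ0 (by norm_num)
    have h2 : (5 / 16 : ℝ) * (1 / 4) ≤ (1 - κ) * (1 - 3 * β) :=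
      mul_le_mul (by linarith) (by linarith) (by norm_num) (by linarith)
    linarith
  · have h1 : β * (α + 1 / 2) ≤ 1 / 4 * (5 / 8) := mul_le_mul hβ (by linarith) (by linarith) (by norm_num)
    have h2 : (5 / 16 : ℝ) * (1 / 2) ≤ (1 - κ) * (1 - 2 * β) :=
      mul_le_mul (by linarith) (by linarith) (by norm_num) (by linarith)
    linarith

/-- Variant: with the weaker `α ≤ 1/4` (which suffices for the interior steps) the creation conditions hold for every
`κ ≤ 5/8`. [cite: Balaban1989LargeFieldI, p.191] -/
theorem creation_conds_quarter {α β κ : ℝ} (hα0 : 0 ≤ α) (hα : α ≤ 1 / 4) (hβ0 : 0 ≤ β) (hβ : β ≤ 1 / 4)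
    (hκ : κ ≤ 5 / 8) :
    α * β ≤ (1 - κ) * (1 - 3 * β) ∧ β * (α + 1 / 2) ≤ (1 - κ) * (1 - 2 * β) := by
  constructor
  · have h1 : α * β ≤ 1 / 4 * (1 / 4) := mul_le_mul hα hβ hβ0 (by norm_num)
    have h2 : (3 / 8 : ℝ) * (1 / 4) ≤ (1 - κ) * (1 - 3 * β) :=
      mul_le_mul (by linarith) (by linarith) (by norm_num) (by linarith)
    linarith
  · have h1 : β * (α + 1 / 2) ≤ 1 / 4 * (3 / 4) := mul_le_mul hβ (by linarith) (by linarith) (by norm_num)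
    have h2 : (3 / 8 : ℝ) * (1 / 2) ≤ (1 - κ) * (1 - 2 * β) :=
      mul_le_mul (by linarith) (by linarith) (by norm_num) (by linarith)
    linarith

/-- **Sharpness of `11/16`** at `β = 1/4`, `α = 1/8`: for every `κ > 11/16` the creation inequality FAILS at the corner
`x = 0` (the limit `n = j − h → ∞`), `y = 1/2` (`j = k − 1`): there `P_n = 3/8`, `P_{n+1} = 1/2`, and
`κ/2 + 1/32 > 3/8 ⟺ κ > 11/16`.  (Threshold of THIS READING of the omitted p. 191 descent; `11/16` is not printed —
locus [Balaban1989LargeFieldI] p. 191.) [folklore] -/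
theorem creation_sharp {κ : ℝ} (hκ : 11 / 16 < κ) :
    ∃ x y : ℝ, 0 ≤ x ∧ x ≤ 1 ∧ 0 ≤ y ∧ y ≤ 1 / 2 ∧
      1 - 3 * (1 / 4 : ℝ) + 2 * (1 / 4) * x + (1 / 4) * y
        < κ * (1 - 3 * (1 / 4) + (1 / 4) * x + 2 * (1 / 4) * y) + (1 / 8) * (1 / 4) :=
  ⟨0, 1 / 2, le_rfl, by norm_num, by norm_num, le_rfl, by linarith⟩

/-- … and at genuine lattice indices: `(h, j, k) = (0, 4, 5)` (`x = 1/16`, `y = 1/2`; `P_n = 13/32`, `P_{n+1} = 33/64`)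
the creation inequality with `β = 1/4`, `α = 1/8` fails for every `κ ≥ 3/4` (`(3/4)(33/64) + 1/32 = 107/256 > 104/256`).
(Threshold of this reading; `3/4` is not printed — locus [Balaban1989LargeFieldI] p. 191.) [folklore] -/
theorem creation_fails_lattice {κ : ℝ} (hκ : 3 / 4 ≤ κ) :
    lfFactor (1 / 4) 0 4 4 5 < κ * lfFactor (1 / 4) 0 5 5 5 + (1 / 8) * (1 / 4) := by
  obtain ⟨-, -, e0, e1⟩ := lfFactor_examples
  rw [e0, e1]
  nlinarith

/-- CREATION step (schematic): level `n+1` gives `q′ < P₁·W′·E′` (`q′ ≥ 0`), the weight and the unit convert as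
`W′E′ ≤ τ·(WE)` (`τ = L₀²ρσ′`), the error model is (1.48) at scale `s = 1` with additive unit `E` (no `L₀`-power), and
`τ(1+αβ) ≤ κ` with `κP₁ + αβ ≤ P₀`: then the level-`n` clause `q < P₀·W·E` holds. [cite: Balaban1989LargeFieldI, p.191] -/
theorem creation_step {q q' α β τ κ P₀ P₁ W W' E E' : ℝ} (hq' : 0 ≤ q') (hα0 : 0 ≤ α) (hβ : 0 ≤ β)
    (hW : 1 ≤ W) (hE : 0 ≤ E) (hW' : 0 ≤ W') (hE' : 0 ≤ E') (hconv : W' * E' ≤ τ * (W * E))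
    (h148 : Ineq148 q q' α β 1 E) (hκ : τ * (1 + α * β) ≤ κ) (hcre : κ * P₁ + α * β ≤ P₀)
    (hn1 : q' < P₁ * W' * E') : q < P₀ * W * E := by
  unfold Ineq148 at h148
  have hW'E' : 0 ≤ W' * E' := mul_nonneg hW' hE'
  have hP₁pos : 0 < P₁ * (W' * E') := by nlinarith
  have hP₁ : 0 < P₁ := by
    rcases lt_or_ge 0 P₁ with h | h
    · exact h
    · exfalso; nlinarith [mul_nonpos_of_nonpos_of_nonneg h hW'E']
  have hαβ : 0 ≤ α * β := mul_nonneg hα0 hβ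
  have hpos : 0 < 1 + α * β * 1 := by nlinarith
  have hWE : 0 ≤ W * E := mul_nonneg (by linarith) hE
  have h1 : P₁ * (W' * E') ≤ P₁ * (τ * (W * E)) := mul_le_mul_of_nonneg_left hconv hP₁.le
  have h2 : α * β * 1 * E ≤ α * β * (W * E) := by
    have hEW : E ≤ W * E := by nlinarith
    nlinarith [mul_le_mul_of_nonneg_left hEW hαβ]
  have h3 : τ * (1 + α * β) * P₁ ≤ κ * P₁ := mul_le_mul_of_nonneg_right hκ hP₁.le
  calc q ≤ q' * (1 + α * β * 1) + α * β * 1 * E := h148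
    _ < P₁ * W' * E' * (1 + α * β * 1) + α * β * 1 * E := by
        have := mul_lt_mul_of_pos_right hn1 hpos; linarith
    _ ≤ P₁ * (τ * (W * E)) * (1 + α * β * 1) + α * β * (W * E) := by
        have := mul_le_mul_of_nonneg_right h1 hpos.le; nlinarith
    _ = (τ * (1 + α * β) * P₁ + α * β) * (W * E) := by ring
    _ ≤ (κ * P₁ + α * β) * (W * E) := by nlinarith
    _ ≤ P₀ * (W * E) := mul_le_mul_of_nonneg_right hcre hWE
    _ = P₀ * W * E := by ring

/-- **CREATION STEP on the diagonal clauses**: the level-`(n+1)` clause with the diagonal factor `lfFactor β h (j+1) (j+1)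
k`, a weight `W′ ≤ L₀²W` and a unit `E′ ≤ ρσ·E` implies the level-`n` clause with the diagonal factor `lfFactor β h j j k`,
weight `W ≥ 1`, unit `E`, PROVIDED `L₀²·ρσ·(1+αβ) ≤ κ ≤ 1` and the two creation conditions hold (`h ≤ j < k`; error
model (1.48) at `s = 1`). [cite: Balaban1989LargeFieldI, p.191] -/
theorem clause_creation {q q' α β κ ρσ L₀ W W' E E' : ℝ} {h j k : ℕ} (hhj : h ≤ j) (hjk : j + 1 ≤ k)
    (hq' : 0 ≤ q') (hα0 : 0 ≤ α) (hβ : 0 ≤ β) (hW : 1 ≤ W) (hW'0 : 0 ≤ W') (hW' : W' ≤ L₀ ^ 2 * W)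
    (hE : 0 ≤ E) (hE'0 : 0 ≤ E') (hE' : E' ≤ ρσ * E) (hκ : L₀ ^ 2 * ρσ * (1 + α * β) ≤ κ) (hκ1 : κ ≤ 1)
    (c1 : α * β ≤ (1 - κ) * (1 - 3 * β)) (c2 : β * (α + 1 / 2) ≤ (1 - κ) * (1 - 2 * β))
    (h148 : Ineq148 q q' α β 1 E) (hn1 : Clause164 q' β h (j + 1) (j + 1) k W' E') :
    Clause164 q β h j j k W E := by
  unfold Clause164 at hn1 ⊢
  have hL₀W : 0 ≤ L₀ ^ 2 * W := mul_nonneg (sq_nonneg _) (by linarith)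
  have hconv : W' * E' ≤ (L₀ ^ 2 * ρσ) * (W * E) := by
    calc W' * E' ≤ (L₀ ^ 2 * W) * (ρσ * E) := mul_le_mul hW' hE' hE'0 hL₀W
      _ = (L₀ ^ 2 * ρσ) * (W * E) := by ring
  have hx : 0 ≤ (1 / 2 : ℝ) ^ (j - h) := by positivity
  have hy0 : 0 ≤ (1 / 2 : ℝ) ^ (k - j) := by positivity
  have hy : (1 / 2 : ℝ) ^ (k - j) ≤ 1 / 2 := by
    have e : k - j = (k - j - 1) + 1 := by omega
    rw [e, pow_succ]
    have : (1 / 2 : ℝ) ^ (k - j - 1) ≤ 1 := pow_le_one₀ (by norm_num) (by norm_num)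
    nlinarith
  have hcre : κ * lfFactor β h (j + 1) (j + 1) k + α * β ≤ lfFactor β h j j k := by
    rw [lfFactor_diag_succ_xy β hhj hjk, lfFactor_diag_xy]
    exact creation_coeff hβ hx hy0 hy hκ1 c1 c2
  exact creation_step hq' hα0 hβ hW hE hW'0 hE'0 hconv h148 hκ hcre hn1

/-- **CREATION for the (ii) shells** `m ≤ j` (`Clause166` at level `n+1`, shell `m`, weight `L₀^{2(j+1−m)} =
L₀²·L₀^{2(j−m)}`, units at scale `j+1` bounded by `ρσ` times the scale-`j` units, `L₀ ≥ 1`) ⇒ `Clause166` at level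
`n`. [cite: Balaban1989LargeFieldI, p.191] -/
theorem clause166_creation {q q' α β κ ρσ L₀ E E' : ℝ} {h j m k : ℕ} (hhj : h ≤ j) (hjk : j + 1 ≤ k)
    (hm : m ≤ j) (hq' : 0 ≤ q') (hα0 : 0 ≤ α) (hβ : 0 ≤ β) (hL₀ : 1 ≤ L₀) (hE : 0 ≤ E) (hE'0 : 0 ≤ E')
    (hE' : E' ≤ ρσ * E) (hκ : L₀ ^ 2 * ρσ * (1 + α * β) ≤ κ) (hκ1 : κ ≤ 1)
    (c1 : α * β ≤ (1 - κ) * (1 - 3 * β)) (c2 : β * (α + 1 / 2) ≤ (1 - κ) * (1 - 2 * β))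
    (h148 : Ineq148 q q' α β 1 E) (hn1 : Clause166 q' β h (j + 1) m k L₀ E') :
    Clause166 q β h j m k L₀ E := by
  unfold Clause166 at hn1 ⊢
  have hW'0 : 0 ≤ W166 L₀ (j + 1) m := pow_nonneg (by linarith) _
  exact clause_creation hhj hjk hq' hα0 hβ (one_le_W166 hL₀ j m) hW'0 (le_of_eq (W166_succ L₀ hm)) hE hE'0
    hE' hκ hκ1 c1 c2 h148 hn1

/-- **CREATION for the top rung of (i)**: the level-`(n+1)` line of (1.64)(i) at its last rung `m = j+1` (region
`(Ω″_{j+1}∖Ω_{k₀+1})∩X`, weight `W164 L₀ (j+1) k₀ ≤ L₀²·W164 L₀ j k₀`, units at scale `j+1`) ⇒ the level-`n` line at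
its last rung `m = j` (region `(Ω″_j∖Ω_{k₀+1})∩X ⊇` the former). [cite: Balaban1989LargeFieldI, p.191] -/
theorem clause164_creation_top {q q' α β κ ρσ L₀ E E' : ℝ} {h j k k₀ : ℕ} (hhj : h ≤ j) (hjk : j + 1 ≤ k)
    (hq' : 0 ≤ q') (hα0 : 0 ≤ α) (hβ : 0 ≤ β) (hL₀ : 1 ≤ L₀) (hE : 0 ≤ E) (hE'0 : 0 ≤ E')
    (hE' : E' ≤ ρσ * E) (hκ : L₀ ^ 2 * ρσ * (1 + α * β) ≤ κ) (hκ1 : κ ≤ 1)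
    (c1 : α * β ≤ (1 - κ) * (1 - 3 * β)) (c2 : β * (α + 1 / 2) ≤ (1 - κ) * (1 - 2 * β))
    (h148 : Ineq148 q q' α β 1 E) (hn1 : Clause164 q' β h (j + 1) (j + 1) k (W164 L₀ (j + 1) k₀) E') :
    Clause164 q β h j j k (W164 L₀ j k₀) E := by
  have hW'0 : 0 ≤ W164 L₀ (j + 1) k₀ := pow_nonneg (by linarith) _
  exact clause_creation hhj hjk hq' hα0 hβ (one_le_W164 hL₀ j k₀) hW'0 (W164_succ_le hL₀ j k₀) hE hE'0 hE'
    hκ hκ1 c1 c2 h148 hn1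

/-! ### The `L₀` restriction (p. 191 *"for example if β ≦ 1/4 and L₀² ≦ (1/3)L. Notice that we get the stronger
restriction on L₀ because of the bounds for A′"*). -/

/-- With the sample growth `ρ ≤ 3/2` (`= 1 + β₀`, `β₀ ≤ 1/2`, the printed growth of `ε_j`, p. 192), `αβ ≤ 1/32`
(`β ≤ 1/4`, `α ≤ 1/8`) and `L₀²σ′ ≤ L₀²/L ≤ 1/3` (the `|A′|` entry, `σ′ = L^{−1}`): `κ = ρ(1+αβ)·(L₀²σ′) ≤ 33/64`.
[cite: Balaban1989LargeFieldI, p.191] -/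
theorem kappa_printed_le {ρ α β σ : ℝ} (hρ : ρ ≤ 3 / 2) (hαβ0 : 0 ≤ α * β)
    (hαβ : α * β ≤ 1 / 32) (hσ0 : 0 ≤ σ) (hσ : σ ≤ 1 / 3) : ρ * (1 + α * β) * σ ≤ 33 / 64 := by
  have h1 : ρ * (1 + α * β) ≤ 3 / 2 * (33 / 32) := mul_le_mul hρ (by linarith) (by linarith) (by norm_num)
  have h2 : ρ * (1 + α * β) * σ ≤ 3 / 2 * (33 / 32) * (1 / 3) := mul_le_mul h1 hσ hσ0 (by norm_num)
  linarith

/-- `33/64 < 11/16 = 44/64`: the printed restriction closes the creation step with room. [folklore] -/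
theorem kappa_printed_lt : (33 / 64 : ℝ) < 11 / 16 := by norm_num

/-- At `αβ = 1/32` and `L₀²/L = 1/3` exactly, `κ = ρ·(33/32)·(1/3) ≤ 11/16` IFF `ρ ≤ 2`: the printed `L₀² ≤ L/3`
tolerates a unit-growth ratio up to `2` per step in the `|A′|` entry.  (Threshold of this reading; `ρ ≤ 2` is not
printed — locus [Balaban1989LargeFieldI] p. 191; see Part E for `ρ` under [Balaban1988Convergent] (2.28).) [folklore] -/
theorem kappa_third_iff_rho_le_two (ρ : ℝ) : ρ * (33 / 32) * (1 / 3) ≤ 11 / 16 ↔ ρ ≤ 2 := by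
  constructor <;> intro h <;> linarith

/-- At `ρ = 3/2`, `αβ = 1/32`: `κ ≤ 11/16` IFF `L₀²σ′ ≤ 4/9` — so for the `|A′|` entry (`σ′ = 1/L`) the sharp form of
the printed restriction is `L₀² ≤ (4/9)L`.  (Threshold of this reading; `4/9` is not printed — locus
[Balaban1989LargeFieldI] p. 191.) [folklore] -/
theorem sigma_sharp_iff (σ : ℝ) : 3 / 2 * (33 / 32) * σ ≤ 11 / 16 ↔ σ ≤ 4 / 9 := by
  constructor <;> intro h <;> linarith

/-- `L₀² ≤ L/3` and `ρ ≤ 3/2` give `ρL₀²/L ≤ 1/2` (`L > 0`; no sign condition on `ρ` is needed). [folklore] -/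
theorem third_L_bound {ρ L₀ L : ℝ} (hL : 0 < L) (hL₀ : L₀ ^ 2 ≤ L / 3) (hρ : ρ ≤ 3 / 2) :
    ρ * L₀ ^ 2 / L ≤ 1 / 2 := by
  rw [div_le_iff₀ hL]
  nlinarith [mul_le_mul hρ hL₀ (sq_nonneg L₀) (by norm_num : (0:ℝ) ≤ 3 / 2)]

/-- The earlier restriction *"L₀ < (1/2)L"* (p. 187) alone leaves `L₀²/L` UNBOUNDED (`L = 16(|K|+1)`, `L₀ = L/4`
gives `L₀²/L = |K| + 1`) — the `|A′|` entry, whose unit `α_{1,m}(L^mη)^{−1}` rescales by `L^{−1}` only, is what forces a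
bound on `L₀²/L` rather than on `L₀²/L²`: *"the stronger restriction on L₀ because of the bounds for A′"*.
(Arithmetic of this reading; the quoted sentences are p. 187 / p. 191 of [Balaban1989LargeFieldI].) [folklore] -/
theorem half_L_unbounded (K : ℝ) : ∃ L L₀ : ℝ, 0 < L ∧ 0 < L₀ ∧ L₀ < L / 2 ∧ K < L₀ ^ 2 / L := by
  have hK : 0 < |K| + 1 := by positivity
  refine ⟨16 * (|K| + 1), 4 * (|K| + 1), by positivity, by positivity, by nlinarith, ?_⟩
  rw [lt_div_iff₀ (by positivity)]
  nlinarith [le_abs_self K]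

/-- For comparison, the REAL top-region coefficient (1.52) at `β = 1/4`, `α = 1/8`: `coeff152 β₀ (1/4) (1/8) L₀ L < 1`
IFF `(1+β₀)(33/32)·L₀²/L² < 27/28` — a condition on `L₀²/L²` (plaquette units rescale by `L^{−2}`), met with room by
`L₀ < L/2`. [cite: Balaban1989LargeFieldI, (1.52) p.187] -/
theorem coeff152_printed_iff (β₀ L₀ L : ℝ) :
    coeff152 β₀ (1 / 4) (1 / 8) L₀ L < 1 ↔ (1 + β₀) * (33 / 32) * (L₀ ^ 2 / L ^ 2) < 27 / 28 := by
  unfold coeff152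
  constructor <;> intro h <;> nlinarith

/-! ### The cube conditions (1.65)/(1.67)/(1.69). -/

/-- **CUBE RESCALING**: if on a cube the level-`(n+1)` bound holds at scale `j+1` — `L·a < W′·BCM·α₀′`,
`L²·da < W′·BCM·α₀′` with `a = L^jη|A|`, `da = (L^jη)²|∇^ηA|` — with `W′ ≤ L₀²W`, `α₀′ ≤ ρα₀`, then the level-`n` bound
`Cube165 a da W B C M α₀` holds as soon as `L₀²ρ ≤ L` (`L ≥ 1`; `U`, `A`, `u` unchanged under the map — NOT CERTIFIED
(d)). [cite: Balaban1989LargeFieldI, (1.67) p.190] -/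
theorem cube165_rescale {a da W W' B C M α₀ α₀' ρ L₀ L : ℝ} (hL : 1 ≤ L) (hW : 0 ≤ W)
    (hW' : W' ≤ L₀ ^ 2 * W) (hK : 0 ≤ B * C * M) (hα₀ : 0 ≤ α₀) (hα₀'0 : 0 ≤ α₀') (hα₀' : α₀' ≤ ρ * α₀)
    (hscale : L₀ ^ 2 * ρ ≤ L) (hn1 : Cube165 (L * a) (L ^ 2 * da) W' B C M α₀') :
    Cube165 a da W B C M α₀ := by
  obtain ⟨h1, h2⟩ := hn1
  have hY : 0 ≤ W * (B * C * M * α₀) := mul_nonneg hW (mul_nonneg hK hα₀)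
  have hL0W : 0 ≤ L₀ ^ 2 * W * (B * C * M) := mul_nonneg (mul_nonneg (sq_nonneg _) hW) hK
  have hbound : W' * (B * C * M * α₀') ≤ L * (W * (B * C * M * α₀)) := by
    calc W' * (B * C * M * α₀') ≤ (L₀ ^ 2 * W) * (B * C * M * α₀') :=
          mul_le_mul_of_nonneg_right hW' (mul_nonneg hK hα₀'0)
      _ = (L₀ ^ 2 * W * (B * C * M)) * α₀' := by ring
      _ ≤ (L₀ ^ 2 * W * (B * C * M)) * (ρ * α₀) := mul_le_mul_of_nonneg_left hα₀' hL0W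
      _ = (L₀ ^ 2 * ρ) * (W * (B * C * M * α₀)) := by ring
      _ ≤ L * (W * (B * C * M * α₀)) := mul_le_mul_of_nonneg_right hscale hY
  have hL0 : (0 : ℝ) ≤ L := by linarith
  constructor
  · exact lt_of_mul_lt_mul_left (h1.trans_le hbound) hL0
  · have h3 : L ^ 2 * da < L ^ 2 * (W * (B * C * M * α₀)) := by
      calc L ^ 2 * da < W' * (B * C * M * α₀') := h2
        _ ≤ L * (W * (B * C * M * α₀)) := hbound
        _ ≤ L ^ 2 * (W * (B * C * M * α₀)) := by
            apply mul_le_mul_of_nonneg_right _ hY; nlinarith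
    exact lt_of_mul_lt_mul_left h3 (by positivity)

/-- For the cube entries `L₀² ≤ L/3` tolerates a growth ratio `ρ ≤ 3`: `L₀²ρ ≤ L` (`L ≥ 0`). [folklore] -/
theorem cube_scale_of_third {ρ L₀ L : ℝ} (hL : 0 ≤ L) (hL₀ : L₀ ^ 2 ≤ L / 3) (hρ : ρ ≤ 3) :
    L₀ ^ 2 * ρ ≤ L := by
  rcases le_or_gt 0 ρ with hρ0 | hρ0
  · nlinarith [mul_le_mul hL₀ hρ hρ0 (by linarith : (0:ℝ) ≤ L / 3)]
  · nlinarith [mul_nonneg (sq_nonneg L₀) (le_of_lt (neg_pos.mpr hρ0))]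

/-- NON-VACUITY of the interior step: a numerical instance of all hypotheses of `clause164_interior` together with its
conclusion (`β = 1/4`, `α = 1/4`, `(h,j,m,k) = (0,4,2,5)`, `W = E = 1`, `q′ = 1/8 < 3/16`, `q = q′(1 + 1/64) + 1/64 =
17/128 < 7/32`). [folklore] -/
theorem interior_instance :
    Ineq148 (17 / 128) (1 / 8) (1 / 4) (1 / 4) ((1 / 2 : ℝ) ^ (4 - 2)) 1 ∧
      Clause164 (1 / 8) (1 / 4) 0 5 2 5 1 1 ∧ Clause164 (17 / 128) (1 / 4) 0 4 2 5 1 1 := by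
  obtain ⟨e0, e1, -, -⟩ := lfFactor_examples
  refine ⟨?_, ?_, ?_⟩
  · unfold Ineq148; norm_num
  · unfold Clause164; rw [e1]; norm_num
  · unfold Clause164; rw [e0]; norm_num

end Descent

/-! ## Part D. *"and the corresponding statement for 𝕁"* (p. 191): the unwritten 𝕁-rule as a parameter.

The configurations of the complex spaces are PAIRS `(𝕌, 𝕁)` with `𝕁` a free `g^c`-valued variable (p. 190), after
[Balaban1987RG1] p. 261: *"We extend the terms in (1.7) introducing two variables 𝐔, 𝐉, the second variable replacing
the functions (1.8)"* [`J_j = D^{ξ*}_{U_j}ξ^{−2}π Im ∂U_j` (1.8)] *", and the first satisfying milder regularity conditions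
involving first order derivatives at most. Thus we assume that there are functions 𝐄^{(j)}(X, g_{j−1}, 𝐔, 𝐉), analytic
on a space of regular, complex configurations 𝐔, 𝐉, such that 𝐄^{(j)}(X, g_{j−1}, U_j) = 𝐄^{(j)}(X, g_{j−1}, U_j, J_j).
(1.9)"*.  The p. 191 claim maps `𝕌 ↦ exp iηℍ^{(n)}_k(…)𝕌 =: Φ𝕌` and says nothing about the image of `𝕁`; the rule
`r` below is that free slot.  Nothing in this Part decides which rule B15 means; it types the slot, three candidate
rules, the consistency requirement that (1.9) imposes on the real slice, and the arithmetic of the increment rule on one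
line of (1.64)(i). -/

section Current

variable {C J : Type*}

/-- The map of the p. 191 claim on pairs: `(𝕌, 𝕁) ↦ (Φ𝕌, r 𝕌 𝕁)`, `r` = the (unwritten) 𝕁-rule. [cite: Balaban1989LargeFieldI, p.191] -/
def pairMap (Φ : C → C) (r : C → J → J) : C × J → C × J := fun p => (Φ p.1, r p.1 p.2)

/-- p. 191, *"if 𝕌 is an element of the space Ũ^{(n+1)c}_k …, then exp iηℍ^{(n)}_k(…)𝕌 is an element of the space
Ũ^{(n)c}_k …, and the corresponding statement for 𝕁"* — with the 𝕁-rule `r` as an explicit parameter (`S₁`, `S₀` =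
membership of a pair in the level-`(n+1)`, level-`n` space). [cite: Balaban1989LargeFieldI, p.191] -/
def Membership191 (S₁ S₀ : C × J → Prop) (Φ : C → C) (r : C → J → J) : Prop := Descends S₁ S₀ (pairMap Φ r)

/-- Unfolded form. Bookkeeping. [folklore] -/
theorem membership191_iff (S₁ S₀ : C × J → Prop) (Φ : C → C) (r : C → J → J) :
    Membership191 S₁ S₀ Φ r ↔ ∀ U x, S₁ (U, x) → S₀ (Φ U, r U x) := by
  simp [Membership191, Descends, pairMap, Prod.forall]

/-- Candidate rule (R0): keep `𝕁`. [folklore] -/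
def ruleKeep : C → J → J := fun _ x => x

/-- Candidate rule (R1): recompute the current of the image, `r 𝕌 𝕁 = J(Φ𝕌)` (`Jof` = the current functional
`𝕌 ↦ J(𝕌)` of [Balaban1987RG1] (1.8), schematic). [cite: Balaban1987RG1, (1.8) p.261] -/
def ruleRecompute (Jof : C → J) (Φ : C → C) : C → J → J := fun U _ => Jof (Φ U)

/-- Candidate rule (R2): increment, `r 𝕌 𝕁 = 𝕁 + (J(Φ𝕌) − J(𝕌))`. [cite: Balaban1987RG1, (1.8) p.261] -/
def ruleIncrement [AddCommGroup J] (Jof : C → J) (Φ : C → C) : C → J → J :=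
  fun U x => x + (Jof (Φ U) - Jof U)

/-- REAL-SLICE CONSISTENCY, the requirement (1.9) of [Balaban1987RG1] p. 261 transported through the step: on real
configurations (`real 𝕌`, where the pair is `(𝕌, J(𝕌))`) the rule must return the current of the image,
`r 𝕌 (J𝕌) = J(Φ𝕌)` — otherwise the extended level-`n` term is not an extension of the real one. Schematic.
[cite: Balaban1987RG1, (1.9) p.261] -/
def RealSliceConsistent (real : C → Prop) (Jof : C → J) (Φ : C → C) (r : C → J → J) : Prop :=
  ∀ U, real U → r U (Jof U) = Jof (Φ U)

/-- (R1) is consistent. [folklore] -/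
theorem ruleRecompute_consistent (real : C → Prop) (Jof : C → J) (Φ : C → C) :
    RealSliceConsistent real Jof Φ (ruleRecompute Jof Φ) := fun _ _ => rfl

/-- (R2) is consistent. [folklore] -/
theorem ruleIncrement_consistent [AddCommGroup J] (real : C → Prop) (Jof : C → J) (Φ : C → C) :
    RealSliceConsistent real Jof Φ (ruleIncrement Jof Φ) := by
  intro U _
  simp [ruleIncrement]

/-- (R0) is consistent IFF the current is unchanged by `Φ` on every real configuration (false as soon as `ℍ^{(n)}_k`
moves the plaquette field) — so with (R0) the membership claim is trivially the inclusion of the spaces but the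
consistency (1.9) is lost. [folklore] -/
theorem ruleKeep_consistent_iff (real : C → Prop) (Jof : C → J) (Φ : C → C) :
    RealSliceConsistent real Jof Φ ruleKeep ↔ ∀ U, real U → Jof U = Jof (Φ U) := Iff.rfl

/-- Every consistent rule of the affine form `𝕁 ↦ 𝕁 + c(𝕌)` has `c(𝕌) = J(Φ𝕌) − J(𝕌)` on the real slice, i.e. agrees
there with the increment rule (R2). [folklore] -/
theorem affine_consistent_iff [AddCommGroup J] (real : C → Prop) (Jof : C → J) (Φ : C → C) (c : C → J) :
    RealSliceConsistent real Jof Φ (fun U x => x + c U) ↔ ∀ U, real U → c U = Jof (Φ U) - Jof U := by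
  refine forall₂_congr fun U _ => ?_
  show Jof U + c U = Jof (Φ U) ↔ _
  constructor
  · intro h; rw [← h]; abel
  · intro h; rw [h]; abel

/-- THE INCREMENT RULE ON ONE LINE OF (1.64)(i), any rung `m` (`h ≤ j`): if the new `𝕁`-quantity satisfies the
triangle inequality `q ≤ q′ + d` and the increment `d` fits into the room freed by the step of the factor,
`d ≤ β2^{−|m−(j+1)|}·W·E` (`lfFactor_succ`), then the level-`(n+1)` line implies the level-`n` line — no condition on
`β`, `α`, `L₀` at all; what it costs is the bound on `d`, i.e. on `J(exp iηℍ𝕌) − J(𝕌)`, a SECOND-derivative quantity of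
`ℍ^{(n)}_k` for which (1.45) (which prints `ℍ` and `∇ℍ` only) has no entry — NOT CERTIFIED (e). [cite: Balaban1989LargeFieldI, p.191] -/
theorem clause164_increment {q q' d β W E : ℝ} {h j m k : ℕ} (hhj : h ≤ j) (htri : q ≤ q' + d)
    (hd : d ≤ β * (1 / 2 : ℝ) ^ Int.natAbs ((m : ℤ) - (j + 1 : ℕ)) * W * E)
    (hn1 : Clause164 q' β h (j + 1) m k W E) : Clause164 q β h j m k W E := by
  unfold Clause164 at hn1 ⊢
  rw [lfFactor_succ β hhj] at hn1
  have e : (lfFactor β h j m k - β * (1 / 2 : ℝ) ^ Int.natAbs ((m : ℤ) - (j + 1 : ℕ))) * W * E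
      = lfFactor β h j m k * W * E - β * (1 / 2 : ℝ) ^ Int.natAbs ((m : ℤ) - (j + 1 : ℕ)) * W * E := by ring
  rw [e] at hn1
  linarith

end Current

/-! ## Part E (v1.1, APPEND-ONLY). The growth ratio `ρ` of the unit sequences under [Balaban1988Convergent] (2.28).

NOT CERTIFIED (c) of the header asks for the growth ratio `ρ = α_{·,j+1}/α_{·,j}` of the sequences `α̃₀ = {α_{0,m}}`,
`α̃₁ = {α_{1,m}}`, which B15 does not define.  [Balaban1988Convergent] (cell paper B14), p. 259 (render p017 read as an
image) prints, for its spaces `U^c_j(X, α_{0,j}, α_{1,j})`: *"The numbers α_{0,j}, α_{1,j} in the symbol of the space are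
given by α_{0,j} = g_jC₀(log g_j^{−2})^{q₀}, α_{1,j} = g_jC₁(log g_j^{−2})^{q₁}, (2.28) where q₀, q₁ are integers greater
than 1, C₀, C₁ are sufficiently large positive numbers"*, and the couplings run by (2.24) *"1/g²_{j−1}(x) = 1/g²_j(x) +
β_j(g_{j−1})φ_j(x)"* (*"φ_j = 1 on Λ_j^{∼−1}. Thus g²_j(x) = g²_j on the last domain"*).  Whether B15's `α_{·,m}` ARE
these numbers is a reading (the symbols match: [III] = [Balaban1988Convergent] p. 261 defines `Ũ^c_j(X, α̃₀, α̃₁)` by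
(2.34)–(2.39) in the units `α_{0,n}`, `α_{1,n}` of its (2.28), citing the regularity conditions to its refs [13–15] — typed
verbatim in the tree module `…Balaban1983to89.B14Radii` — while B15 p. 190 names the spaces without a citation; v1.1's
wording *"B15 cites its spaces to [15], [16]"* was an unsupported attribution — B15 prints no *"[15]"* at all and its
p. 191 *"[16]"* is attached to the constant `B` — corrected after the delta cross-read GAPS C-b02g22-1 D-1); under that
reading the lemmas
below bound `ρ` by the one-step coupling ratio `g_{j+1}/g_j`, and that ratio by `2` as soon as the one-step
`β`-coefficient `b ≥ 0` has `b·g_j² ≤ 3/4` — so the threshold `ρ ≤ 2` of `kappa_third_iff_rho_le_two` is met with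
room for small couplings.  The sign and size of `β_j` ((I.0.20)–(0.23) of [Balaban1987RG1]) and the flow control
`g_k ∈ ]0, γ]` (Theorem 2 of [Balaban1987RG1], unproved in print) are HYPOTHESES here, not facts. -/

section Growth

/-- [Balaban1988Convergent] (2.28) p. 259, schematic: `α_{·,j} = g_j·C·(log g_j^{−2})^{q}` with the logarithm
`x_j := log g_j^{−2}` kept as a separate real argument (`alphaB14 C g x q = g·C·x^q`); the tie `x = log g^{−2}` is
`logInvSq` below. [cite: Balaban1988Convergent, (2.28) p.259] -/
noncomputable def alphaB14 (C g x : ℝ) (q : ℕ) : ℝ := g * C * x ^ q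

/-- `x = log g^{−2} = −2 log g`. [cite: Balaban1988Convergent, (2.28) p.259] -/
noncomputable def logInvSq (g : ℝ) : ℝ := Real.log ((g ^ 2)⁻¹)

/-- `log g^{−2}` is positive for `0 < g < 1` (a larger coupling has a smaller logarithm, next lemma). [folklore] -/
theorem logInvSq_pos {g : ℝ} (hg : 0 < g) (hg1 : g < 1) : 0 < logInvSq g := by
  unfold logInvSq
  apply Real.log_pos
  have h1 : g ^ 2 < 1 := by nlinarith
  have h2 : 0 < g ^ 2 := by positivity
  exact one_lt_inv_iff₀.mpr ⟨h2, h1⟩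

/-- `log g^{−2}` is DEcreasing in `g > 0`. [folklore] -/
theorem logInvSq_antitone {g g' : ℝ} (hg : 0 < g) (hgg : g ≤ g') : logInvSq g' ≤ logInvSq g := by
  unfold logInvSq
  have hg' : 0 < g' := lt_of_lt_of_le hg hgg
  have h2 : 0 < g ^ 2 := by positivity
  have h2' : 0 < g' ^ 2 := by positivity
  apply Real.log_le_log (inv_pos.mpr h2')
  exact inv_anti₀ h2 (by nlinarith)

/-- THE RATIO IS AT MOST THE COUPLING RATIO: for `0 < g ≤ g′`, `0 ≤ x′ ≤ x`, `C ≥ 0`: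
`α(C, g′, x′, q) ≤ (g′/g)·α(C, g, x, q)` — the logarithmic factor only helps. [folklore] -/
theorem alphaB14_ratio_le {C g g' x x' : ℝ} {q : ℕ} (hC : 0 ≤ C) (hg : 0 < g) (hgg : g ≤ g') (hx' : 0 ≤ x')
    (hxx : x' ≤ x) : alphaB14 C g' x' q ≤ g' / g * alphaB14 C g x q := by
  unfold alphaB14
  have hpow : x' ^ q ≤ x ^ q := pow_le_pow_left₀ hx' hxx q
  have hg' : 0 ≤ g' := le_trans hg.le hgg
  have e : g' / g * (g * C * x ^ q) = g' * C * x ^ q := by field_simp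
  rw [e]
  have : 0 ≤ g' * C := mul_nonneg hg' hC
  exact mul_le_mul_of_nonneg_left hpow this

/-- ONE RG STEP, [Balaban1988Convergent] (2.24) p. 259 on the last domain (`φ = 1`): `1/g² = 1/g′² + b` with the
coefficient `b = β_{j+1}(g_j) ≥ 0` (the sign is (I.0.20)–(0.23) of [Balaban1987RG1], a HYPOTHESIS here).  If
`b·g² ≤ 3/4` then `g′ ≤ 2g`. [cite: Balaban1988Convergent, (2.24) p.259] -/
theorem coupling_ratio_le_two {g g' b : ℝ} (hg : 0 < g) (hg' : 0 < g') (hstep : 1 / g ^ 2 = 1 / g' ^ 2 + b)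
    (hb : b * g ^ 2 ≤ 3 / 4) : g' ≤ 2 * g := by
  have h2 : 0 < g ^ 2 := by positivity
  have h2' : 0 < g' ^ 2 := by positivity
  -- 1/g'^2 = 1/g^2 - b ≥ 1/(4 g^2)
  have key : 1 / (4 * g ^ 2) ≤ 1 / g' ^ 2 := by
    have hb' : b ≤ 3 / (4 * g ^ 2) := by
      rw [le_div_iff₀ (by positivity)]; nlinarith
    have : 1 / g ^ 2 - 3 / (4 * g ^ 2) = 1 / (4 * g ^ 2) := by field_simp; ring
    rw [← this]; linarith
  have hsq : g' ^ 2 ≤ 4 * g ^ 2 := by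
    have h4 : 0 < 4 * g ^ 2 := by positivity
    exact (one_div_le_one_div h4 h2').mp key
  nlinarith [hsq, hg, hg']

/-- Under the one-step relation the coupling does not decrease (`b ≥ 0`): `g ≤ g′`. [folklore] -/
theorem coupling_monotone {g g' b : ℝ} (hg : 0 < g) (hg' : 0 < g') (hstep : 1 / g ^ 2 = 1 / g' ^ 2 + b)
    (hb : 0 ≤ b) : g ≤ g' := by
  have h2 : 0 < g ^ 2 := by positivity
  have h2' : 0 < g' ^ 2 := by positivity
  have key : 1 / g' ^ 2 ≤ 1 / g ^ 2 := by linarith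
  have hsq : g ^ 2 ≤ g' ^ 2 := (one_div_le_one_div h2' h2).mp key
  nlinarith [hsq, hg, hg']

/-- THE GROWTH RATIO UNDER (2.24)/(2.28): `0 < g_j`, `0 < g_{j+1} < 1`, one RG step with `0 ≤ b`, `b·g_j² ≤ 3/4`, `C ≥ 0`
⇒ `α_{·,j+1} ≤ 2·α_{·,j}`, i.e. `ρ ≤ 2` — the threshold of `kappa_third_iff_rho_le_two` (creation step at the printed
`L₀² = L/3`, `αβ = 1/32`). CONDITIONAL on reading B15's `α_{·,m}` as B14's (2.28) and on the hypotheses named in the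
Part E docstring. [folklore] -/
theorem rho_le_two_B14 {C g g' b : ℝ} {q : ℕ} (hC : 0 ≤ C) (hg : 0 < g) (hg' : 0 < g') (hg'1 : g' < 1)
    (hstep : 1 / g ^ 2 = 1 / g' ^ 2 + b) (hb0 : 0 ≤ b) (hb : b * g ^ 2 ≤ 3 / 4) :
    alphaB14 C g' (logInvSq g') q ≤ 2 * alphaB14 C g (logInvSq g) q := by
  have hmono : g ≤ g' := coupling_monotone hg hg' hstep hb0
  have hratio : g' ≤ 2 * g := coupling_ratio_le_two hg hg' hstep hb
  have hx' : 0 ≤ logInvSq g' := (logInvSq_pos hg' hg'1).le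
  have hxx : logInvSq g' ≤ logInvSq g := logInvSq_antitone hg hmono
  calc alphaB14 C g' (logInvSq g') q ≤ g' / g * alphaB14 C g (logInvSq g) q :=
        alphaB14_ratio_le hC hg hmono hx' hxx
    _ ≤ 2 * alphaB14 C g (logInvSq g) q := by
        have hα : 0 ≤ alphaB14 C g (logInvSq g) q := by
          unfold alphaB14
          have : 0 ≤ logInvSq g := le_trans hx' hxx
          positivity
        have : g' / g ≤ 2 := by rw [div_le_iff₀ hg]; linarith
        exact mul_le_mul_of_nonneg_right this hα

/-- … and then the creation step closes at the printed `L₀² = L/3`, `α = 1/8`, `β = 1/4` for every corner: with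
`ρ := α′/α ≤ 2`, `κ := ρ·(33/32)·(1/3) ≤ 11/16` (`kappa_third_iff_rho_le_two`), hence both conditions
of `creation_coeff` hold (`creation_conds_printed`). [folklore] -/
theorem creation_closes_of_rho_le_two {ρ : ℝ} (hρ : ρ ≤ 2) :
    ρ * (33 / 32) * (1 / 3) ≤ 11 / 16 ∧
      (1 / 8 : ℝ) * (1 / 4) ≤ (1 - ρ * (33 / 32) * (1 / 3)) * (1 - 3 * (1 / 4)) ∧
      (1 / 4 : ℝ) * (1 / 8 + 1 / 2) ≤ (1 - ρ * (33 / 32) * (1 / 3)) * (1 - 2 * (1 / 4)) := by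
  refine ⟨by linarith, by nlinarith, by nlinarith⟩

end Growth

end Literature.MathematicalPhysics.QuantumFieldTheory.Balaban1983to89.B15.ComplexSpaces
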